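import Mathlib
import Summits.PneNP.PneNP.Theses.LatticeMagic
import Literature.Computability.MetaComplexity.XorPseudoexpectation
import Literature.Computability.MetaComplexity.SOSThreeColouringProofs
import Summits.PneNP.PneNP.Theorems.LatticeMagicBooleanSosBlindAtConstantFactorDefs
import Summits.PneNP.PneNP.Theorems.LatticeMagicBooleanSosBlindAtConstantFactorStubParity
import Summits.PneNP.PneNP.Theorems.LatticeMagicBooleanSosBlindAtEveryFactorNo
import Summits.PneNP.PneNP.Theorems.LatticeMagicBooleanSosBlindAtEveryFactorFooled
import Summits.PneNP.PneNP.Theorems.LatticeMagicBooleanSosBlindAtEveryFactorEncode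

/-!
# PneNP / LatticeMagic — `BooleanSosBlindAtEveryFactor` (stmt-PneNP-16059): the closing file

`Summit.PneNP.PneNP.Theses.LatticeMagic.BooleanSosBlindAtEveryFactor` — FACTOR-INSENSITIVITY of the
Boolean bit-SOS rung at LINEAR degree: there is an absolute `c > 0` such that for every bit-size
exponent regime `k` (with `C = k + 4`) and every factor function `γ` with `1 ≤ γ(n) ≤ 2^(n^k)`
eventually, in infinitely many dimensions `n` some NO-instance of `GapCVP_γ` of bit-size `≤ n^C` with
bit budget `m = 2 ≤ n^C` has its bit-encoded closeness system satisfied by a degree-`⌈c·n⌉` Boolean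
pseudoexpectation — PROVED along road A of the planner's plan (task `strengthen-sos-blind`):

* the instances are the Construction-A lattices of the unsatisfiable cover-expanding 3-CNFs of
  `ThreeColGadget.exists_unsat_coverExpander` (read as 3-XOR systems; `N = K²` variables, `6N`
  clauses, dimension `n = 7K²`, threshold `d₀ = K`) with the CHECK BLOCK SCALED by `M = 2^T`,
  `T = n^k + ⌊log₂ K⌋ + 2`: basis `[[2·I_N, M·incBlock], [0, 2M·I_{6N}]]`, target `(1, …, 1 | M·rhsBit)`;
* NO at factor `γ`: every lattice vector pays `≥ N + M²` (`scaled_no`, file `…EveryFactorNo.lean`),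
  and `M > 2^(n^k) · K ≥ γ(n) · K`;
* fooled at degree `⌈(κ/100) · n⌉` (`κ` the expansion constant): the pushed-forward
  Grigoriev–Schoenebeck functional never sees `M` (`scaled_fooled`, file `…EveryFactorFooled.lean`),
  and the expansion parameter `⌊κN⌋` is linear in `n = 7N`;
* bit-size `≤ 100 ((n+1)² (T + 2) + ⌊log₂ K⌋ + 1) ≤ n^(k+4)` (`bounded_encode_le`, file
  `…EveryFactorEncode.lean`: entries `≤ 2M = 2^(T+1)`, logarithmic size).

The parity step `stub_parity` (CNF-unsat ⇒ XOR-unsat) and the vocabulary (`closenessPoly`, `Fooled`,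
`rhsBit`, `XorUnsat`) are the crux's (`LatticeMagicBooleanSosBlindAtConstantFactor{Defs,StubParity}`).
Sources: Grigoriev 2001 (TCS 259) §2; Schoenebeck 2008 Thm. 4.1/§5; Kothari–Mori–O'Donnell–Witmer
2017 Def. 2.7–2.8; Chvátal–Szemerédi 1988 (unsatisfiable expanding formulas); Conway–Sloane
Construction A / Micciancio–Goldwasser 2002 Ch. 1; nearest print: Ghazi–Lee 2014 (arXiv:1410.4241,
Lasserre vs LDPC decoding).
-/

set_option linter.dupNamespace false -- `Summit.PneNP.PneNP.…`: summit = sub-problem (D-0017)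

namespace Summit.PneNP.PneNP.Theorems.ConAScaled

open scoped BigOperators
open Literature.Algebra.EuclideanLattices Literature.Computability.Complexity
  Literature.Computability.MetaComplexity Summit.PneNP.PneNP.Theorems.ConA

noncomputable section

/-! ## The item, read back -/

/-- Readback: the item is LITERALLY `∃ c > 0, ∀ k, ∃ C, ∀ γ (≥ 1, eventually ≤ 2^(n^k)), ∀ n₀, ∃ p m,
n₀ ≤ n ∧ p ∈ GapCVP.no γ ∧ |code p| ≤ n^C ∧ m ≤ n^C ∧ Fooled ⌈c · n⌉₊ p m` (definitional unfolding
only, with the crux's line vocabulary `Fooled` / `closenessPoly`). -/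
theorem everyFactor_iff : Summit.PneNP.PneNP.Theses.LatticeMagic.BooleanSosBlindAtEveryFactor ↔
    ∃ c : ℝ, 0 < c ∧ ∀ k : ℕ, ∃ C : ℕ, ∀ γ : ℕ → ℝ, (∀ n, 1 ≤ γ n) →
      (∃ n₁ : ℕ, ∀ n, n₁ ≤ n → γ n ≤ 2 ^ (n ^ k)) → ∀ n₀ : ℕ, ∃ (p : GapCVPInstance) (m : ℕ),
      n₀ ≤ p.1.I.n ∧ p ∈ GapCVP.no γ ∧ (GapCVPInstance.encode p).length ≤ p.1.I.n ^ C ∧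
      m ≤ p.1.I.n ^ C ∧ Fooled ⌈c * (p.1.I.n : ℝ)⌉₊ p m :=
  Iff.rfl

/-! ## The deciding theorem -/

/-- **`BooleanSosBlindAtEveryFactor` holds** (route `LatticeMagic`, item stmt-PneNP-16059): with
`c = κ/100` (`κ` the Chvátal–Szemerédi expansion constant of `exists_unsat_coverExpander`) and
`C = k + 4`, for every admissible factor function `γ` and every `n₀` there is a NO-instance of
`GapCVP_γ` — the Construction-A lattice of an unsatisfiable expanding 3-XOR system on `N = K²`
variables with its check block scaled by `M = 2^(n^k + ⌊log₂ K⌋ + 2)` — of dimension `n = 7K² ≥ n₀`,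
bit-size `≤ n^(k+4)`, bit budget `2`, whose closeness system is satisfied by a degree-`⌈c·n⌉` Boolean
pseudoexpectation: the composition of `stub_parity`, `scaled_no`, `scaled_fooled`,
`bounded_encode_le`. -/
theorem booleanSosBlindAtEveryFactor_proof :
    Summit.PneNP.PneNP.Theses.LatticeMagic.BooleanSosBlindAtEveryFactor := by
  classical
  rw [everyFactor_iff]
  obtain ⟨κ, hκ, -, N₀, hgood⟩ := ThreeColGadget.exists_unsat_coverExpander
  refine ⟨κ / 100, by positivity, fun k => ⟨k + 4, fun γ hγ1 hγb n₀ => ?_⟩⟩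
  obtain ⟨n₁, hγ⟩ := hγb
  -- the size parameter `K` (dimension `n = 7 K²`)
  obtain ⟨K, hK⟩ : ∃ K : ℕ, N₀ + n₀ + n₁ + ⌈(160 : ℝ) / κ⌉₊ + 20 ≤ K := ⟨_, le_rfl⟩
  have hK20 : 20 ≤ K := by omega
  have hKN₀ : N₀ ≤ K := by omega
  have hKn₀ : n₀ ≤ K := by omega
  have hKn₁ : n₁ ≤ K := by omega
  have hK160 : ⌈(160 : ℝ) / κ⌉₊ ≤ K := by omega
  have hKpos : 0 < K := by omega
  have hKr : (20 : ℝ) ≤ K := by exact_mod_cast hK20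
  have hκK : (160 : ℝ) ≤ κ * K := by
    have h1 : (160 : ℝ) / κ ≤ K := (Nat.le_ceil _).trans (by exact_mod_cast hK160)
    rwa [div_le_iff₀ hκ, mul_comm] at h1
  obtain ⟨N, hN⟩ : ∃ N : ℕ, N = K ^ 2 := ⟨_, rfl⟩
  have hNK : K ≤ N := by rw [hN]; nlinarith
  have hN₀ : N₀ ≤ N := hKN₀.trans hNK
  have hNr : (N : ℝ) = (K : ℝ) ^ 2 := by rw [hN]; push_cast; ring
  have hN400 : 400 ≤ N := by rw [hN]; nlinarith
  -- the unsatisfiable expanding 3-CNF on `N` variables with `6 N` clauses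
  obtain ⟨f, hunsat, hcov⟩ := hgood N hN₀
  obtain ⟨C, hCf⟩ : ∃ C : Fin (6 * N) → Clause ℕ, C = fun e => (f e : Clause ℕ) := ⟨_, rfl⟩
  have hC : ∀ e, C e ∈ kClauses 3 N := fun e => by rw [hCf]; exact (f e).2
  have hunsat' : ¬ CNF.Satisfiable (List.ofFn C) := by rw [hCf]; exact hunsat
  have hcov' : IsCoverExpander (fun e => clauseScope (C e)) ⌊κ * N⌋₊ (7 / 4) := by
    rw [hCf]; exact hcov
  -- vector expansion of the scope vectors
  have hsc : ∀ e, (clauseScope (C e)).card ≤ 3 := fun e =>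
    (card_clauseScope_le _).trans (length_of_mem_kClauses (hC e)).le
  have hbd : IsBoundaryExpander (fun e => clauseScope (C e)) ⌊κ * N⌋₊ (1 / 2) := by
    refine IsCoverExpander.isBoundaryExpander (k := 3) hsc ?_
    norm_num
    exact hcov'
  have hvec : VecExpands (fun e => clauseVec (C e)) ⌊κ * N⌋₊ (1 / 2) := by
    have h : (fun e => clauseVec (C e)) = fun e => indVec (clauseScope (C e)) :=
      funext fun e => clauseVec_eq_indVec (nodup_map_fst_of_mem_kClauses (hC e))
    rw [h]
    exact vecExpands_of_isBoundaryExpander hbd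
  -- the dimension
  have hn7 : N + 6 * N = 7 * K ^ 2 := by rw [hN]; ring
  have hn7r : ((N + 6 * N : ℕ) : ℝ) = 7 * (N : ℝ) := by push_cast; ring
  have hnK : K ≤ N + 6 * N := by omega
  have hn₁ : n₁ ≤ N + 6 * N := hKn₁.trans hnK
  -- degrees: `D = ⌈(κ/100) n⌉`, `Dx = 3 D + 3 ≤ ⌊κ N⌋ / 4`
  obtain ⟨D, hD⟩ : ∃ D : ℕ, D = ⌈κ / 100 * ((N + 6 * N : ℕ) : ℝ)⌉₊ := ⟨_, rfl⟩
  have hDlt : (D : ℝ) < κ / 100 * (7 * (N : ℝ)) + 1 := by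
    rw [hD, hn7r]
    exact Nat.ceil_lt_add_one (by positivity)
  have hfloor : κ * N - 1 < (⌊κ * N⌋₊ : ℕ) := Nat.sub_one_lt_floor _
  have hκN : (160 : ℝ) * K ≤ κ * N := by rw [hNr]; nlinarith
  have hκN' : (3200 : ℝ) ≤ κ * N := by nlinarith
  have hr2 : (2 : ℝ) ≤ (⌊κ * N⌋₊ : ℕ) := by linarith
  have hDx : (((3 * D + 3 : ℕ)) : ℝ) ≤ 1 / 2 * (⌊κ * N⌋₊ : ℕ) / 2 := by
    push_cast
    linarith
  -- the scale `M = 2^T`, `T = n^k + ⌊log₂ K⌋ + 2`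
  obtain ⟨T, hT⟩ : ∃ T : ℕ, T = (N + 6 * N) ^ k + Nat.log 2 K + 2 := ⟨_, rfl⟩
  obtain ⟨M, hM⟩ : ∃ M : ℤ, M = 2 ^ T := ⟨_, rfl⟩
  have hMpos : 0 < M := by rw [hM]; positivity
  have hM0 : M ≠ 0 := hMpos.ne'
  have hMr : (M : ℝ) = (2 : ℝ) ^ T := by rw [hM]; push_cast; ring
  -- the scaled Construction-A basis and target
  obtain ⟨B, hB⟩ : ∃ B : Matrix (Fin (N + 6 * N)) (Fin (N + 6 * N)) ℤ,
      B = Matrix.reindex finSumFinEquiv finSumFinEquiv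
        (Matrix.fromBlocks (Matrix.diagonal fun _ => (2 : ℤ))
          (Matrix.of fun (a : Fin N) (e : Fin (6 * N)) => if (a : ℕ) ∈ clauseScope (C e) then M else 0)
          0 (Matrix.diagonal fun _ => 2 * M)) := ⟨_, rfl⟩
  obtain ⟨t, ht⟩ : ∃ t : Fin (N + 6 * N) → ℤ,
      t = fun j => Sum.elim (fun _ => (1 : ℤ)) (fun e => M * rhsBit (C e)) (finSumFinEquiv.symm j) :=
    ⟨_, rfl⟩
  have hB₁₁ : ∀ a' a : Fin N, B (Fin.castAdd (6 * N) a') (Fin.castAdd (6 * N) a) =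
      if a' = a then 2 else 0 := fun a' a => by
    simp [hB, Matrix.reindex_apply, Matrix.submatrix_apply, Matrix.diagonal_apply]
  have hB₂₁ : ∀ (e' : Fin (6 * N)) (a : Fin N), B (Fin.natAdd N e') (Fin.castAdd (6 * N) a) = 0 :=
    fun e' a => by simp [hB, Matrix.reindex_apply, Matrix.submatrix_apply]
  have hB₁₂ : ∀ (a' : Fin N) (e : Fin (6 * N)), B (Fin.castAdd (6 * N) a') (Fin.natAdd N e) =
      if (a' : ℕ) ∈ clauseScope (C e) then M else 0 := fun a' e => by
    simp [hB, Matrix.reindex_apply, Matrix.submatrix_apply]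
  have hB₂₂ : ∀ e' e : Fin (6 * N), B (Fin.natAdd N e') (Fin.natAdd N e) =
      if e' = e then 2 * M else 0 := fun e' e => by
    simp [hB, Matrix.reindex_apply, Matrix.submatrix_apply, Matrix.diagonal_apply]
  have ht₁ : ∀ a : Fin N, t (Fin.castAdd (6 * N) a) = 1 := fun a => by simp [ht]
  have ht₂ : ∀ e : Fin (6 * N), t (Fin.natAdd N e) = M * rhsBit (C e) := fun e => by simp [ht]
  -- parity: CNF-unsat ⇒ XOR-unsat
  have hX : XorUnsat N (6 * N) C := stub_parity C hC hunsat'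
  -- NO at factor `γ`: `γ(n) · K < 2^(n^k) · 2^(⌊log₂ K⌋ + 1) ≤ M`
  have hγ0 : 0 ≤ γ (N + 6 * N) := zero_le_one.trans (hγ1 _)
  have hγn : γ (N + 6 * N) ≤ 2 ^ ((N + 6 * N) ^ k) := hγ (N + 6 * N) hn₁
  have hKlog : (K : ℝ) < 2 ^ (Nat.log 2 K + 1) := by
    exact_mod_cast Nat.lt_pow_succ_log_self (by norm_num) K
  have hγM : γ (N + 6 * N) * K < (M : ℝ) := by
    have h1 : γ (N + 6 * N) * K < 2 ^ ((N + 6 * N) ^ k) * (2 : ℝ) ^ (Nat.log 2 K + 1) :=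
      calc γ (N + 6 * N) * K ≤ 2 ^ ((N + 6 * N) ^ k) * (K : ℝ) :=
            mul_le_mul_of_nonneg_right hγn (Nat.cast_nonneg K)
        _ < 2 ^ ((N + 6 * N) ^ k) * (2 : ℝ) ^ (Nat.log 2 K + 1) :=
            mul_lt_mul_of_pos_left hKlog (by positivity)
    have h2 : (2 : ℝ) ^ ((N + 6 * N) ^ k) * (2 : ℝ) ^ (Nat.log 2 K + 1) ≤ (M : ℝ) := by
      rw [← pow_add, hMr]
      exact pow_le_pow_right₀ (by norm_num) (by rw [hT]; omega)
    exact h1.trans_le h2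
  have hd0 : (0 : ℚ) < (K : ℚ) := by exact_mod_cast hKpos
  have hKQ : (((K : ℚ)) : ℝ) = (K : ℝ) := by push_cast; ring
  have hgap : (γ (N + 6 * N) * (((K : ℚ)) : ℝ)) ^ 2 < N + (M : ℝ) ^ 2 := by
    rw [hKQ]
    have h0 : 0 ≤ γ (N + 6 * N) * K := mul_nonneg hγ0 (Nat.cast_nonneg K)
    have hN0 : (0 : ℝ) ≤ N := Nat.cast_nonneg N
    nlinarith
  have hno : ((⟨⟨N + 6 * N, B⟩, t⟩, (K : ℚ)) : GapCVPInstance) ∈ GapCVP.no γ :=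
    scaled_no C M B t hX hM0 hB₁₁ hB₂₁ hB₁₂ hB₂₂ ht₁ ht₂ (K : ℚ) hd0 γ hγ0 hgap
  -- fooled at degree `D`
  have hfl : ⌊(((K : ℚ)) : ℝ) ^ 2⌋ = (N : ℤ) := by
    have : (((K : ℚ)) : ℝ) ^ 2 = ((N : ℤ) : ℝ) := by rw [hKQ, Int.cast_natCast, hNr]
    rw [this, Int.floor_intCast]
  have hfool : Fooled D ((⟨⟨N + 6 * N, B⟩, t⟩, (K : ℚ)) : GapCVPInstance) 2 :=
    scaled_fooled C hC M B t hB₁₁ hB₂₁ hB₁₂ hB₂₂ ht₁ ht₂ hvec (by norm_num) hr2 hDx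
      (le_refl (3 * D + 3)) (K : ℚ) hfl
  -- bit-size: entries `≤ 2M = 2^(T+1)`
  obtain ⟨A, hA⟩ : ∃ A : ℕ, A = 2 ^ (T + 1) := ⟨_, rfl⟩
  have hMnat : M.natAbs = 2 ^ T := by rw [hM]; simp [Int.natAbs_pow]
  have h2Mnat : (2 * M).natAbs = 2 ^ (T + 1) := by
    rw [Int.natAbs_mul, hMnat, pow_succ]
    simp [mul_comm]
  have hA2 : 2 ≤ A := by
    rw [hA, pow_succ]
    have : 1 ≤ 2 ^ T := Nat.one_le_two_pow
    omega
  have hAM : M.natAbs ≤ A := by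
    rw [hMnat, hA]
    exact Nat.pow_le_pow_right (by norm_num) (by omega)
  have hA2M : (2 * M).natAbs ≤ A := by rw [h2Mnat, hA]
  have hBA : ∀ i j, (B i j).natAbs ≤ A := by
    intro i j
    rw [hB, Matrix.reindex_apply, Matrix.submatrix_apply]
    cases finSumFinEquiv.symm i with
    | inl a' =>
      cases finSumFinEquiv.symm j with
      | inl a =>
        rw [Matrix.fromBlocks_apply₁₁, Matrix.diagonal_apply]
        split_ifs
        · simpa using hA2
        · simp
      | inr e =>
        rw [Matrix.fromBlocks_apply₁₂, Matrix.of_apply]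
        split_ifs
        · exact hAM
        · simp
    | inr e' =>
      cases finSumFinEquiv.symm j with
      | inl a =>
        rw [Matrix.fromBlocks_apply₂₁]
        simp
      | inr e =>
        rw [Matrix.fromBlocks_apply₂₂, Matrix.diagonal_apply]
        split_ifs
        · exact hA2M
        · simp
  have htA : ∀ j, (t j).natAbs ≤ A := by
    intro j
    induction j using Fin.addCases with
    | left a =>
      rw [ht₁]
      exact le_trans (by norm_num) hA2
    | right e =>
      rw [ht₂]
      rcases rhsBit_eq_zero_or_one (C e) with h | h
      · rw [h, mul_zero]
        exact Nat.zero_le _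
      · rw [h, mul_one]
        exact hAM
  have hlogA : Nat.log 2 A = T + 1 := by
    have h := Nat.log_pow (b := 2) one_lt_two (T + 1)
    rw [← hA] at h
    exact h
  -- sizes: `100 ((n+1)² (T+2) + ⌊log₂ K⌋ + 1) ≤ n^(k+4)` for `n = 7K² ≥ 2800` (pure arithmetic first)
  have hn2800 : 2800 ≤ N + 6 * N := by omega
  obtain ⟨P, hP⟩ : ∃ P : ℕ, P = (N + 6 * N) ^ k := ⟨_, rfl⟩
  have hP1 : 1 ≤ P := by rw [hP]; exact Nat.one_le_pow _ _ (by omega)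
  have hlogK : Nat.log 2 K ≤ K := Nat.log_le_self 2 K
  have hT2 : T + 1 + 1 ≤ 2 * (P * (N + 6 * N)) := by
    have h1 : T + 1 + 1 ≤ P + (N + 6 * N) := by rw [hT, ← hP]; omega
    have h2 : P ≤ P * (N + 6 * N) := Nat.le_mul_of_pos_right P (by omega)
    have h3 : N + 6 * N ≤ P * (N + 6 * N) := Nat.le_mul_of_pos_left _ hP1
    omega
  have hsq : (N + 6 * N + 1) ^ 2 ≤ 2 * (N + 6 * N) ^ 2 := by
    have h3n : 3 * (N + 6 * N) ≤ (N + 6 * N) * (N + 6 * N) := Nat.mul_le_mul_right _ (by omega)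
    calc (N + 6 * N + 1) ^ 2 = (N + 6 * N) * (N + 6 * N) + 2 * (N + 6 * N) + 1 := by ring
      _ ≤ (N + 6 * N) * (N + 6 * N) + (N + 6 * N) * (N + 6 * N) := by omega
      _ = 2 * (N + 6 * N) ^ 2 := by ring
  have h1 : (N + 6 * N + 1) ^ 2 * (T + 1 + 1) ≤ (2 * (N + 6 * N) ^ 2) * (2 * (P * (N + 6 * N))) :=
    Nat.mul_le_mul hsq hT2
  have hn3 : N + 6 * N ≤ P * (N + 6 * N) ^ 3 := by
    calc N + 6 * N = 1 * (N + 6 * N) ^ 1 := by ring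
      _ ≤ P * (N + 6 * N) ^ 3 :=
          Nat.mul_le_mul hP1 (Nat.pow_le_pow_right (by omega) (by norm_num))
  have h2 : Nat.log 2 K + 1 ≤ P * (N + 6 * N) ^ 3 := by omega
  have hpow : (N + 6 * N) ^ (k + 4) = P * (N + 6 * N) ^ 3 * (N + 6 * N) := by rw [hP]; ring
  have hbound : 100 * ((N + 6 * N + 1) ^ 2 * (T + 1 + 1) + Nat.log 2 K + 1) ≤ (N + 6 * N) ^ (k + 4) := by
    rw [hpow]
    have h3 : (2 * (N + 6 * N) ^ 2) * (2 * (P * (N + 6 * N))) = 4 * (P * (N + 6 * N) ^ 3) := by ring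
    rw [h3] at h1
    calc 100 * ((N + 6 * N + 1) ^ 2 * (T + 1 + 1) + Nat.log 2 K + 1)
        ≤ 100 * (4 * (P * (N + 6 * N) ^ 3) + P * (N + 6 * N) ^ 3) := by omega
      _ = 500 * (P * (N + 6 * N) ^ 3) := by ring
      _ ≤ (N + 6 * N) * (P * (N + 6 * N) ^ 3) := Nat.mul_le_mul_right _ (by omega)
      _ = P * (N + 6 * N) ^ 3 * (N + 6 * N) := by ring
  have hm : 2 ≤ (N + 6 * N) ^ (k + 4) := by
    rw [hpow]
    have h4 : 1 ≤ P * (N + 6 * N) ^ 3 := le_trans (by norm_num) h2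
    calc 2 ≤ 1 * 2800 := by norm_num
      _ ≤ P * (N + 6 * N) ^ 3 * (N + 6 * N) := Nat.mul_le_mul h4 hn2800
  have hlen : (GapCVPInstance.encode ((⟨⟨N + 6 * N, B⟩, t⟩, (K : ℚ)) : GapCVPInstance)).length ≤
      (N + 6 * N) ^ (k + 4) := by
    have h0 := bounded_encode_le (N + 6 * N) B t A K hBA htA
    rw [hlogA] at h0
    exact h0.trans hbound
  have hn₀ : n₀ ≤ N + 6 * N := by omega
  refine ⟨((⟨⟨N + 6 * N, B⟩, t⟩, (K : ℚ)) : GapCVPInstance), 2, hn₀, hno, hlen, hm, ?_⟩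
  show Fooled ⌈κ / 100 * ((N + 6 * N : ℕ) : ℝ)⌉₊ ((⟨⟨N + 6 * N, B⟩, t⟩, (K : ℚ)) : GapCVPInstance) 2
  rw [← hD]
  exact hfool

end

end Summit.PneNP.PneNP.Theorems.ConAScaled
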